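import Literature.Analysis.FluidPDE.PassiveVectorTensorPropagatorLossMonotone
import Literature.Analysis.FluidPDE.PassiveVectorTensorPropagatorEnergy
import Literature.Analysis.FunctionSpaces.TorusTimeAverage
import HarnessLib

/-!
# The passive-vector propagator tested against a STEADY smooth solenoidal field: the generator-level (short-window) bound

Analysis/FluidPDE proof-support file (theorems only; no definitions, no named facts).  For the solution propagator
`Torus.IsPropagator T b 𝔹 U` (constant tensor `NearIso 𝔹 lo hi`, `0 < lo`, bounded a.e. divergence-free carrier `b`), a smooth
divergence-free steady test `G`, and a constant `N` dominating the `L²` norm of the generator applied to the test,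
`‖(b(τ)·∇)G + 𝓛_𝔹^* G‖_{L²} ≤ N` for every `τ`:

* `IsPropagator.abs_inner_sub_inner_le_of_steadyTest` — **`|⟪U s t y, G⟫ − ⟪y, G⟫| ≤ (t − s) · N · ‖y‖`** for `0 ≤ s ≤ t ≤ T` and every
  `y ∈ L²` (du Bois-Reymond form of the weak formulation with the steady test `G`,
  `IsWeakTensorPassiveVectorOn.ae_integral_inner_eq`, on ONE weak solution from the Leray projection of `y`, which `U` represents
  (`IsPropagator.repr`); the integrand is `≤ N·‖U s σ y‖ ≤ N·‖y‖` by Cauchy–Schwarz and the contraction property; a.e. `t` ⟹ every `t` by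
  the weak continuity of `U`; the endpoint `t = T` through the propagator on a longer horizon, which restricts to `U` by uniqueness).

This is the «generator level» tool that pays the SHORT windows of every block of the (V_mod) flat stage of K1L_D
(stmt-AnomalousDissipation-27980; certifier table `Cruxes/LagrangianRenormalisationStep/Lines/onelevel-ss-regimes.md` §2 T-G/T-G′, rows «τ < P»):
for a slow test `G` (a real trigonometric polynomial) `N ≤ ‖b‖_∞·‖∇G‖₂ + ‖𝓛_𝔹^*G‖₂` is explicit in the modes of `G`.
[cite: DiPernaLions1989, §II.1 (12)–(14)] [cite: Temam1984, Ch. III §1 Lemma 1.2, Lemma 1.4] [cite: Pazy1983, Ch. 5 §5.1 Def. 5.3]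

## Mathlib / tree search
Tree: `PassiveVectorTensorClass` (`IsWeakTensorPassiveVectorOn.ae_integral_inner_eq`, `integrableOn_steadyRHS` in `…ModeEnergy`),
`PassiveVectorTensorPropagator` (`IsPropagator`, `exists_isPropagator`, `windowSol_spec`, `divFreeL2`), `…PropagatorUnique`
(`apply_eq_apply_starProjection`, `eq_of_isPropagator`), `…PropagatorLossMonotone` (`IsPropagator.of_horizon_le`), `…PropagatorEnergy`
(`le_on_Icc_of_ae_le_of_continuousOn₂`).  Mathlib: `L2.inner_def`, `Lp.toLp_coeFn`, `Submodule.starProjection_inner_eq_zero`,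
`Submodule.norm_starProjection_apply_le`, `norm_setIntegral_le_of_norm_le_const_ae`.
-/

open MeasureTheory Set Filter Topology UnitAddTorus Function
open scoped ENNReal NNReal InnerProductSpace

noncomputable section

namespace Literature.Analysis.FluidPDE

namespace Torus

open FunctionSpaces.Torus FunctionSpaces

variable {d : Type*} [Fintype d] [DecidableEq d] [Nonempty d]
variable {T : ℝ} {𝔹 : Visc4 d} {lo hi : ℝ} {b : ℝ → UnitAddTorus d → EuclideanSpace ℝ d}
  {U : ℝ → ℝ → (Lp (EuclideanSpace ℝ d) 2 (volume : Measure (UnitAddTorus d)) →L[ℝ]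
    Lp (EuclideanSpace ℝ d) 2 (volume : Measure (UnitAddTorus d)))}

omit [DecidableEq d] [Nonempty d] in
/-- The `L²` pairing of two `L²` representatives is the inner product of their classes. [folklore] -/
private theorem integral_inner_eq_inner_toLp {f g : UnitAddTorus d → EuclideanSpace ℝ d} (hf : MemLp f 2 volume) (hg : MemLp g 2 volume) :
    ∫ x, ⟪f x, g x⟫_ℝ = ⟪hf.toLp f, hg.toLp g⟫_ℝ := by
  rw [L2.inner_def]
  exact integral_congr_ae (by
    filter_upwards [hf.coeFn_toLp, hg.coeFn_toLp] with x hx hy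
    rw [hx, hy])

omit [DecidableEq d] [Nonempty d] in
/-- Cauchy–Schwarz for the pairing of an `L²` representative with a field of `L²` norm at most `N`. [folklore] -/
private theorem abs_integral_inner_le_of_eLpNorm_le {f g : UnitAddTorus d → EuclideanSpace ℝ d} (hf : MemLp f 2 volume) (hg : MemLp g 2 volume)
    {N : ℝ} (hN0 : 0 ≤ N) (hN : eLpNorm g 2 volume ≤ ENNReal.ofReal N) :
    |∫ x, ⟪f x, g x⟫_ℝ| ≤ ‖hf.toLp f‖ * N := by
  rw [integral_inner_eq_inner_toLp hf hg]
  refine (abs_real_inner_le_norm _ _).trans (mul_le_mul_of_nonneg_left ?_ (norm_nonneg _))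
  rw [Lp.norm_toLp]
  exact ENNReal.toReal_le_of_le_ofReal hN0 hN

omit [Nonempty d] in
/-- **The propagator tested against a steady smooth solenoidal field, OPEN horizon** (`t < T`): `|⟪U s t y, G⟫ − ⟪y, G⟫| ≤ (t − s)·N·‖y‖`.
[cite: DiPernaLions1989, §II.1 (12)–(14)] [cite: Temam1984, Ch. III §1 Lemma 1.4] -/
theorem IsPropagator.abs_inner_sub_inner_le_of_steadyTest_of_lt (hU : IsPropagator T b 𝔹 U) (h𝔹 : NearIso 𝔹 lo hi) (hlo : 0 < lo)
    (hb : MemLp (stLift b) ∞ (volume.restrict (Ioo 0 T ×ˢ univ)))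
    (hbdiv : ∀ᵐ τ ∂(volume.restrict (Ioo 0 T)), FunctionSpaces.Torus.IsWeaklyDivFree (b τ))
    {G : UnitAddTorus d → EuclideanSpace ℝ d} (hG : FunctionSpaces.Torus.IsSmooth G) (hGdiv : FunctionSpaces.Torus.IsDivFree G)
    {N : ℝ} (hN0 : 0 ≤ N)
    (hN : ∀ τ, MemLp (fun x => FunctionSpaces.Torus.convect (b τ) G x + viscAdj 𝔹 G x) 2 volume ∧
      eLpNorm (fun x => FunctionSpaces.Torus.convect (b τ) G x + viscAdj 𝔹 G x) 2 volume ≤ ENNReal.ofReal N)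
    {s t : ℝ} (hs : 0 ≤ s) (hst : s ≤ t) (htT : t < T) (y : Lp (EuclideanSpace ℝ d) 2 (volume : Measure (UnitAddTorus d))) :
    |⟪U s t y, (hG.memLp 2).toLp G⟫_ℝ - ⟪y, (hG.memLp 2).toLp G⟫_ℝ| ≤ (t - s) * N * ‖y‖ := by
  set G' : Lp (EuclideanSpace ℝ d) 2 (volume : Measure (UnitAddTorus d)) := (hG.memLp 2).toLp G with hG'def
  -- the test class is divergence free, so only the Leray projection of `y` is seen on both sides
  have hGw : FunctionSpaces.Torus.IsWeaklyDivFree G := hGdiv.isWeaklyDivFree_holds hG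
  have hG'mem : G' ∈ divFreeL2 d := (mem_divFreeL2_iff _).2 (hGw.congr_ae (MemLp.coeFn_toLp _).symm)
  set P := (divFreeL2 d).starProjection with hPdef
  set y' := P y with hy'def
  have hy' : FunctionSpaces.Torus.IsWeaklyDivFree ((y' : Lp (EuclideanSpace ℝ d) 2 volume) : UnitAddTorus d → EuclideanSpace ℝ d) :=
    isWeaklyDivFree_starProjection y
  have hUy : U s t y = U s t y' := hU.apply_eq_apply_starProjection s t y
  have hyG : ⟪y, G'⟫_ℝ = ⟪y', G'⟫_ℝ := by
    have h0 : ⟪y - y', G'⟫_ℝ = 0 := (divFreeL2 d).starProjection_inner_eq_zero y G' hG'mem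
    rw [inner_sub_left] at h0
    linarith
  have hny : ‖y'‖ ≤ ‖y‖ := (divFreeL2 d).norm_starProjection_apply_le y
  rw [hUy, hyG]
  refine le_trans ?_ (mul_le_mul_of_nonneg_left hny (mul_nonneg (sub_nonneg.2 hst) hN0))
  -- the case `t = s`
  rcases hst.eq_or_lt with heq | hst'
  · subst heq
    rw [hU.self_of_divFree s hs htT.le y' hy', sub_self, abs_zero, sub_self, zero_mul, zero_mul]
  have hsT : s < T := hst'.trans htT
  -- ONE weak solution from `y'` on `[s, T)`, represented by `U`
  set φ : UnitAddTorus d → EuclideanSpace ℝ d := (y' : UnitAddTorus d → EuclideanSpace ℝ d) with hφdef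
  have hφ : MemLp φ 2 volume := Lp.memLp y'
  have hyφ : hφ.toLp φ = y' := Lp.toLp_coeFn y' hφ
  set w := windowSol h𝔹 hlo hb hbdiv hs hsT hφ hy' with hwdef
  have hw : IsWeakTensorPassiveVectorOn 0 (T - s) 𝔹 (fun τ => b (s + τ)) φ w := windowSol_spec h𝔹 hlo hb hbdiv hs hsT hφ hy'
  have hrep := hU.repr s hs hsT φ hφ hy' w hw
  -- the steady-test identity and the bound on its integrand
  set Φ : ℝ → ℝ := fun σ =>
    (∫ x, ⟪w σ x, FunctionSpaces.Torus.convect (b (s + σ)) G x + viscAdj 𝔹 G x⟫_ℝ) +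
      0 * ∫ x, ⟪b (s + σ) x, FunctionSpaces.Torus.convect (w σ) G x⟫_ℝ with hΦdef
  have hid := hw.ae_integral_inner_eq hG hGdiv
  have hΦle : ∀ᵐ σ ∂(volume.restrict (Ioo 0 (T - s))), ‖Φ σ‖ ≤ N * ‖y'‖ := by
    filter_upwards [hrep] with σ hσ
    obtain ⟨hm, he⟩ := hσ
    rw [hΦdef]
    simp only [zero_mul, add_zero]
    rw [Real.norm_eq_abs]
    have h1 := abs_integral_inner_le_of_eLpNorm_le hm (hN (s + σ)).1 hN0 (hN (s + σ)).2
    rw [he, hyφ] at h1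
    calc |∫ x, ⟪w σ x, FunctionSpaces.Torus.convect (b (s + σ)) G x + viscAdj 𝔹 G x⟫_ℝ| ≤ ‖U s (s + σ) y'‖ * N := h1
      _ ≤ ‖y'‖ * N := mul_le_mul_of_nonneg_right (hU.norm_le _ _ _) hN0
      _ = N * ‖y'‖ := mul_comm _ _
  -- a.e. `τ ∈ (0, T − s)`: the bound at time `s + τ`
  have hae : ∀ᵐ τ ∂(volume.restrict (Ioo 0 (T - s))), |⟪U s (s + τ) y', G'⟫_ℝ - ⟪y', G'⟫_ℝ| ≤ τ * N * ‖y'‖ := by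
    filter_upwards [hrep, hid, ae_restrict_mem measurableSet_Ioo] with τ hτr hτi hτm
    obtain ⟨hm, he⟩ := hτr
    have e1 : ⟪U s (s + τ) y', G'⟫_ℝ = ∫ x, ⟪w τ x, G x⟫_ℝ := by
      rw [hG'def, integral_inner_eq_inner_toLp hm (hG.memLp 2), he, hyφ]
    have e2 : ⟪y', G'⟫_ℝ = ∫ x, ⟪φ x, G x⟫_ℝ := by
      rw [hG'def, integral_inner_eq_inner_toLp hφ (hG.memLp 2), hyφ]
    rw [e1, e2, hτi, add_sub_cancel_left]
    have hΦτ : ∀ᵐ σ ∂(volume.restrict (Ioc 0 τ)), ‖Φ σ‖ ≤ N * ‖y'‖ := by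
      rw [← Measure.restrict_congr_set Ioo_ae_eq_Ioc]
      exact ae_restrict_of_ae_restrict_of_subset (Ioo_subset_Ioo le_rfl hτm.2.le) hΦle
    have key := norm_setIntegral_le_of_norm_le_const_ae (measure_Ioc_lt_top (a := (0:ℝ)) (b := τ)) hΦτ
    rw [Real.norm_eq_abs, Measure.real, Real.volume_Ioc, sub_zero, ENNReal.toReal_ofReal hτm.1.le] at key
    calc |∫ σ in Ioc 0 τ, Φ σ| ≤ N * ‖y'‖ * τ := key
      _ = τ * N * ‖y'‖ := by ring
  -- every `t` by weak continuity
  set θ : ℝ := t - s with hθdef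
  have hθ0 : 0 < θ := by rw [hθdef]; linarith
  have hθT : θ < T - s := by rw [hθdef]; linarith
  have hf : ContinuousOn (fun τ => |⟪U s (s + τ) y', G'⟫_ℝ - ⟪y', G'⟫_ℝ|) (Icc 0 θ) := by
    have hc := hU.continuousOn s hs hsT.le y' G'
    have hc' : ContinuousOn (fun τ => ⟪U s (s + τ) y', G'⟫_ℝ) (Icc 0 θ) :=
      hc.comp (continuous_const.add continuous_id).continuousOn fun τ hτ => ⟨by linarith [hτ.1], by linarith [hτ.2]⟩
    exact (hc'.sub continuousOn_const).abs
  have hg : ContinuousOn (fun τ => τ * N * ‖y'‖) (Icc 0 θ) := ((continuous_id.mul continuous_const).mul continuous_const).continuousOn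
  have hfg : ∀ᵐ τ ∂(volume.restrict (Ioo 0 θ)), |⟪U s (s + τ) y', G'⟫_ℝ - ⟪y', G'⟫_ℝ| ≤ τ * N * ‖y'‖ :=
    ae_restrict_of_ae_restrict_of_subset (Ioo_subset_Ioo le_rfl hθT.le) hae
  have key := le_on_Icc_of_ae_le_of_continuousOn₂ hθ0 hf hg hfg θ ⟨hθ0.le, le_rfl⟩
  simpa only [hθdef, add_sub_cancel] using key

/-- **THE PROPAGATOR TESTED AGAINST A STEADY SMOOTH SOLENOIDAL FIELD** (generator-level bound, all admissible times `0 ≤ s ≤ t ≤ T`):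
for `IsPropagator T b 𝔹 U` with `NearIso 𝔹 lo hi`, `0 < lo`, a carrier bounded and a.e. weakly divergence-free on a longer horizon
`(0, T₁)`, `T < T₁`, a smooth divergence-free steady test `G` and `N ≥ 0` with `‖(b(τ)·∇)G + 𝓛_𝔹^*G‖_{L²} ≤ N` for every `τ`:

  `|⟪U s t y, G⟫ − ⟪y, G⟫| ≤ (t − s) · N · ‖y‖`   for every `y ∈ L²`.

(`…_of_lt` on the propagator of horizon `T₁`, which restricts to `U` by uniqueness.)
[cite: DiPernaLions1989, §II.1 (12)–(14)] [cite: Temam1984, Ch. III §1 Lemma 1.2, Lemma 1.4] [cite: Pazy1983, Ch. 5 §5.1 Def. 5.3] -/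
theorem IsPropagator.abs_inner_sub_inner_le_of_steadyTest (hU : IsPropagator T b 𝔹 U) (h𝔹 : NearIso 𝔹 lo hi) (hlo : 0 < lo)
    {T₁ : ℝ} (hT₁ : T < T₁) (hb : MemLp (stLift b) ∞ (volume.restrict (Ioo 0 T₁ ×ˢ univ)))
    (hbdiv : ∀ᵐ τ ∂(volume.restrict (Ioo 0 T₁)), FunctionSpaces.Torus.IsWeaklyDivFree (b τ))
    {G : UnitAddTorus d → EuclideanSpace ℝ d} (hG : FunctionSpaces.Torus.IsSmooth G) (hGdiv : FunctionSpaces.Torus.IsDivFree G)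
    {N : ℝ} (hN0 : 0 ≤ N)
    (hN : ∀ τ, MemLp (fun x => FunctionSpaces.Torus.convect (b τ) G x + viscAdj 𝔹 G x) 2 volume ∧
      eLpNorm (fun x => FunctionSpaces.Torus.convect (b τ) G x + viscAdj 𝔹 G x) 2 volume ≤ ENNReal.ofReal N)
    {s t : ℝ} (hs : 0 ≤ s) (hst : s ≤ t) (htT : t ≤ T) (y : Lp (EuclideanSpace ℝ d) 2 (volume : Measure (UnitAddTorus d))) :
    |⟪U s t y, (hG.memLp 2).toLp G⟫_ℝ - ⟪y, (hG.memLp 2).toLp G⟫_ℝ| ≤ (t - s) * N * ‖y‖ := by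
  -- the carrier data on `(0, T)`
  have hsub : Ioo 0 T ×ˢ (univ : Set (EuclideanSpace ℝ d)) ⊆ Ioo 0 T₁ ×ˢ univ :=
    prod_mono (Ioo_subset_Ioo le_rfl hT₁.le) subset_rfl
  have hbT : MemLp (stLift b) ∞ (volume.restrict (Ioo 0 T ×ˢ univ)) := hb.mono_measure (Measure.restrict_mono hsub le_rfl)
  have hbdivT : ∀ᵐ τ ∂(volume.restrict (Ioo 0 T)), FunctionSpaces.Torus.IsWeaklyDivFree (b τ) :=
    ae_restrict_of_ae_restrict_of_subset (Ioo_subset_Ioo le_rfl hT₁.le) hbdiv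
  -- the propagator on the longer horizon restricts to `U`
  obtain ⟨U₁, hU₁⟩ := exists_isPropagator (T := T₁) h𝔹 hlo hb hbdiv
  have hU₁T : IsPropagator T b 𝔹 U₁ := hU₁.of_horizon_le h𝔹 hlo hb hbdiv hT₁.le
  rw [hU.eq_of_isPropagator hU₁T h𝔹 hlo hbT hbdivT hs hst htT y]
  exact hU₁.abs_inner_sub_inner_le_of_steadyTest_of_lt h𝔹 hlo hb hbdiv hG hGdiv hN0 hN hs hst (lt_of_le_of_lt htT hT₁) y

end Torus

end Literature.Analysis.FluidPDE

end
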